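import Summits.CriticalPhenomena.PercolationContinuityZ3.Theorems.PercNearOneGluingNoHeavyLowerTailQ44VertexCoverConeS3
import Summits.CriticalPhenomena.PercolationContinuityZ3.Theorems.PercNearOneGluingNoHeavyLowerTailQ44TTConeUniversal

/-!
# Universality of the terminal-edge cone: the instance for the row `S3`

Support file for crux `stmt-CriticalPhenomena-4575`, seat `prim-bnk-1` gen 39; memo `run/shared/lean/prim/prim-l12/FROM-prim-bnk-1-gen39-TT-CONE-UNIVERSAL.md`.
Companion of `…Q44TTConeUniversal` (engine and the `W` instance): the 36 rays `raysS3` of the landed vertex-cover certificate `…Q44VertexCoverConeS3` are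
(positive multiples of) images of the kernel under TERMINAL-EDGE words (`raysS3_words`, from 35 one-step identities `raysS3_step` checked by
`native_decide` — computational — along the suffix-closed word table `wordsS3`), hence **`inCone_tact_S3`** (a gadget table that maps the kernel into the
cone maps the whole cone into itself) and **`tactList_botbot_nonneg_S3`**: for every list of component tables `Gs` with `InCone raysS3 (tact G kS3)` and every
vertex-cover word `wd`, `0 ≤ (tactList Gs (actWord wd kS3))(⊥,⊥)` (nonnegative two-copy fibre defect of the row `S3`).  No sorries; standard axioms +
`Lean.ofReduceBool`.
-/

namespace Summit.CriticalPhenomena.PercolationContinuityZ3.Theorems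

namespace VCCone

open Finset TwoCopyMono

/-- The kernel of the row `S3` (as in `…Q44VertexCoverConeS3`). [this work] -/
def kS3 : Ker := fun i j => kerS3 i j

/-- Scaling factors: `(gS3 k) • raysS3 k` is a word image of `kS3`. [this work] -/
def gS3 (k : Fin 36) : ℕ := if k.1 = 11 ∨ k.1 = 24 ∨ k.1 = 26 then 2 else 1

/-- Head generator (terminal edge `0 Eab … 5 Ecy`) of the word of ray `k` (`k ≥ 1`). [this work] -/
def hdS3Tab : Array ℕ :=
  #[0, 0, 1, 2, 3, 4, 5, 0, 0, 0, 0, 0, 1, 1, 1, 1, 2, 2, 2, 3, 3, 4, 0, 0, 0, 0, 0, 0, 1, 1, 1, 1, 1, 2, 2, 2]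

/-- The ray whose word is the tail of the word of ray `k` (`k ≥ 1`). [this work] -/
def prevS3Tab : Array ℕ :=
  #[0, 0, 0, 0, 0, 0, 0, 2, 3, 4, 5, 6, 3, 4, 5, 6, 4, 5, 6, 5, 6, 6, 12, 14, 15, 16, 18, 19, 16, 17, 19, 20, 21, 19, 20, 21]

/-- Head generator of ray `k`. [this work] -/
def hdS3 (k : Fin 36) : Fin 17 := ⟨(hdS3Tab[k.1]!) % 17, Nat.mod_lt _ (by decide)⟩

/-- Tail ray of ray `k`. [this work] -/
def prevS3 (k : Fin 36) : Fin 36 := ⟨(prevS3Tab[k.1]!) % 36, Nat.mod_lt _ (by decide)⟩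

/-- The terminal-edge word of ray `k` (generator indices `0…5`). [this work] -/
def wordsS3Tab : Array (List ℕ) :=
  #[[], [0], [1], [2], [3], [4], [5], [0, 1], [0, 2], [0, 3], [0, 4], [0, 5], [1, 2], [1, 3], [1, 4], [1, 5], [2, 3], [2, 4], [2, 5], [3, 4], [3, 5], [4, 5], [0, 1, 2], [0, 1, 4], [0, 1, 5], [0, 2, 3], [0, 2, 5], [0, 3, 4], [1, 2, 3], [1, 2, 4], [1, 3, 4], [1, 3, 5], [1, 4, 5], [2, 3, 4], [2, 3, 5], [2, 4, 5]]

/-- The word of ray `k`. [this work] -/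
def wordsS3 (k : Fin 36) : List (Fin 17) :=
  (wordsS3Tab[k.1]!).map fun m => ⟨m % 17, Nat.mod_lt _ (by decide)⟩

/-- All scaling factors are positive. [this work] -/
theorem gS3_pos : ∀ k : Fin 36, 0 < gS3 k := by decide

/-- The tail ray has a smaller index. [this work] -/
theorem prevS3_lt : ∀ k : Fin 36, k ≠ 0 → prevS3 k < k := by decide

/-- The word table is suffix closed along `prevS3`/`hdS3`. [this work] -/
theorem wordsS3_cons : ∀ k : Fin 36, k ≠ 0 → wordsS3 k = hdS3 k :: wordsS3 (prevS3 k) := by decide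

/-- The empty word belongs to ray 0. [this work] -/
theorem wordsS3_zero : wordsS3 0 = [] := by decide

/-- The 35 one-step identities `(g k)·rays k = (g (prev k))·(E_(hd k)·rays (prev k))` (finite check). [this work] -/
theorem raysS3_step : ∀ k : Fin 36, k ≠ 0 → ∀ x y : Fin 15,
    (gS3 k : ℤ) * raysS3 k x y = (gS3 (prevS3 k) : ℤ) * act (hdS3 k) (raysS3 (prevS3 k)) x y := by
  native_decide

/-- **The rays of the `S3` certificate are terminal-edge word images of the kernel** (up to the factors `gS3`). [this work] -/
theorem raysS3_words : ∀ k : Fin 36, ∀ x y : Fin 15, (gS3 k : ℤ) * raysS3 k x y = actWord (wordsS3 k) kS3 x y := by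
  suffices h : ∀ m : ℕ, ∀ k : Fin 36, k.1 = m → ∀ x y : Fin 15,
      (gS3 k : ℤ) * raysS3 k x y = actWord (wordsS3 k) kS3 x y from fun k => h k.1 k rfl
  intro m
  induction m using Nat.strong_induction_on with
  | _ m ih =>
    intro k hk x y
    by_cases h0 : k = 0
    · subst h0
      rw [wordsS3_zero]
      show (gS3 0 : ℤ) * raysS3 0 x y = kS3 x y
      rw [raysS3_zero x y]
      simp [gS3, kS3]
    · rw [raysS3_step k h0 x y, wordsS3_cons k h0]
      have hlt : (prevS3 k).1 < m := hk ▸ prevS3_lt k h0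
      have ihk : ∀ x y, (gS3 (prevS3 k) : ℤ) * raysS3 (prevS3 k) x y = actWord (wordsS3 (prevS3 k)) kS3 x y :=
        ih _ hlt (prevS3 k) rfl
      have hfun : (fun i j => (gS3 (prevS3 k) : ℤ) * raysS3 (prevS3 k) i j) = actWord (wordsS3 (prevS3 k)) kS3 := by
        funext i j; exact ihk i j
      rw [← act_smul, hfun]
      rfl

/-- The kernel is in its cone. [this work] -/
theorem inCone_kS3 : InCone raysS3 kS3 := inCone_S3

/-- **Universality for `S3`.**  A table that maps `kS3` into the cone maps the whole cone into itself. [this work] -/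
theorem inCone_tact_S3 {G : Table} (hG : InCone raysS3 (tact G kS3)) {M : Ker} (hM : InCone raysS3 M) :
    InCone raysS3 (tact G M) :=
  inCone_tact_of_base raysS3 invariant_S3 wordsS3 gS3 gS3_pos raysS3_words hG hM

/-- **Row `S3` (fibre form) on every graph built from certified components**: for every list of gadget tables `Gs` with
`InCone raysS3 (tact G kS3)` and every vertex-cover word `wd`, `0 ≤ (tactList Gs (actWord wd kS3))(⊥,⊥)`. [this work] -/
theorem tactList_botbot_nonneg_S3 (Gs : List Table) (hGs : ∀ G ∈ Gs, InCone raysS3 (tact G kS3))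
    (wd : List (Fin 17)) : 0 ≤ tactList Gs (actWord wd kS3) 0 0 :=
  tactList_botbot_nonneg_of_base raysS3 invariant_S3 raysS3_botbot inCone_kS3 wordsS3 gS3 gS3_pos raysS3_words Gs hGs wd

end VCCone

end Summit.CriticalPhenomena.PercolationContinuityZ3.Theorems
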